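import Mathlib
import HarnessLib

/-!
# ValiantsHypothesis / LacunarySymmetroid — crux `MatrixDescartes` (stmt-ValiantsHypothesis-18050, V1),
# LINE (A) «product_plus_one», floor `OneChangeFloorK3`: the RATE-VARIANCE IDENTITY of a block of rows (riser-rate dynamics)

Setting (✓ `…SeparatingWeight*`, ✓ `…SeparatingWeightPullConvex`, ✓ `…ZeroChangeConcavityBudgetRiccati`): in the variable `u = log x`
every row `g_j` of a one-change company obeys the LOGISTIC RICCATI LAW `φ_j′ = φ_j·τ_j`, `τ_j = K_j − φ_j`, where `φ_j = θg_j/g_j`,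
`K_j = θN_j/N_j` is the row's CAPACITY (`N_j = −θg_j` for an incoherent row; `K_j` climbs from `p` to `q` along the row's wall) and
`τ_j = θ log|φ_j|` is its LAG; and `τ_j′ = κ_j − φ_j τ_j` with `κ_j = θ² log N_j = pq(q−p)²·|b_j||c_j|·x^{p+q}/N_j² ≥ 0`
(✓ `sepWeight_pull_theta_identities`: `N·θ²N − (θN)² = pq(q−p)²βγx^px^q`).  At a zero of `Φ = Σ_j φ_j` in a gap, `Φ′ > 0` (an UP-CROSSING,
the only source of extra critical points) iff the switched block's rate `A = ⟨τ⟩_S = R′/R` (`R = Σ_{switched} φ_j`) exceeds the pullers' rate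
`⟨τ⟩_U`, which is NON-DECREASING along the gap (✓ `…PullConvex`).  This file types the DYNAMICS OF THE SWITCHED RATE — the other half:

* ★ `blockRate_wronskian_identity` (pure algebra, any finite block, any reals): with `R = Σφ_j`, `R₁ = Σφ_jτ_j`, `R₂ = Σφ_j(τ_j² + κ_j − φ_jτ_j)`
  (the values of `R`, `R′`, `R″` under the Riccati law),
  `R·R₂ − R₁² = R·Σ_j φ_j(κ_j − φ_jτ_j) + ½·Σ_iΣ_j φ_iφ_j(τ_i − τ_j)²`
  — i.e. `(log R)″ = ⟨κ⟩ − ⟨φτ⟩ + Var_φ(τ)` (φ-weighted means): CAPACITY RAMPS and LAG DISPERSION push the block rate UP; the ONLY term that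
  can pull it down is the `φ²`-weighted POSITIVE LAG `Σ_j φ_j²τ_j`;
* `blockRate_wronskian_ge` — hence `R·R₂ − R₁² ≥ −R·Σ_j φ_j²τ_j` for `φ_j ≥ 0`, `κ_j ≥ 0`;
* `hasDerivAt_blockSum` / `hasDerivAt_blockRate_sum` — calculus wiring: for differentiable `φ_j, τ_j` with `φ_j′ = φ_jτ_j`, `τ_j′ = κ_j − φ_jτ_j`
  the block sums `R`, `R₁` have derivatives `R₁`, `R₂`;
* ★ `blockRate_deriv_ge` — the located law in calculus form: at such a point, `R > 0`, `φ_j ≥ 0`, `κ_j ≥ 0` ⇒ the block rate `A = R₁/R` satisfies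
  `A′ ≥ −(Σ_j φ_j²τ_j)/R`; in particular (`blockRate_deriv_nonneg_of_lag_nonpos`) the switched rate is NON-DECREASING wherever no switched row
  lags (`τ_j ≤ 0` for all `j`), so — with ✓ pull log-convexity — a gap on which every switched row LEADS its capacity (`φ_j ≥ K_j`) carries
  `Φ′ = (A − ⟨τ⟩_U)·R` with `A − ⟨τ⟩_U`… [no counting claim is made here: the descent budget `∫ Σ φ_j²τ_j⁺` is the open charging quantity].

HONEST FRAMING: an identity + its one-line consequences (helper toward the floor's missing GLOBAL budget; the pullers' half is ✓ `…PullConvex`);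
closes NO stub; NOT `OneChangeFloorK3` / `stub_eulerBoundK3` / `stub_classRowK3` / `stub_polyLaw` / `MatrixDescartes`; `VP ≠ VNP` is NOT proved.
No definitions, no named facts, no sorry; Mathlib only.

[folklore] Lagrange's identity / weighted-variance bookkeeping and the quotient rule; no citation needed.
-/

set_option linter.dupNamespace false

namespace Summit.ValiantsHypothesis.ValiantsHypothesis.Theorems.LacunarySymmetroidMatrixDescartes

namespace ProductPlusOne

open Finset

/-! ## §1 The rate-variance identity (pure algebra) -/

/-- **Lagrange form of the φ-weighted variance**: `Σ_iΣ_j φ_iφ_j(τ_i − τ_j)² = 2·(Σφ)(Σφτ²) − 2·(Σφτ)²`. [folklore] -/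
theorem blockRate_lagrange {ι : Type*} (s : Finset ι) (φ τ : ι → ℝ) :
    ∑ i ∈ s, ∑ j ∈ s, φ i * φ j * (τ i - τ j) ^ 2
      = 2 * ((∑ j ∈ s, φ j) * (∑ j ∈ s, φ j * τ j ^ 2)) - 2 * (∑ j ∈ s, φ j * τ j) ^ 2 := by
  have h : ∀ i ∈ s, ∑ j ∈ s, φ i * φ j * (τ i - τ j) ^ 2
      = (φ i * τ i ^ 2) * (∑ j ∈ s, φ j) + φ i * (∑ j ∈ s, φ j * τ j ^ 2)
        - 2 * ((φ i * τ i) * (∑ j ∈ s, φ j * τ j)) := by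
    intro i _
    rw [mul_sum, mul_sum, mul_sum, ← sum_add_distrib, mul_sum, ← sum_sub_distrib]
    refine sum_congr rfl fun j _ => ?_
    ring
  rw [sum_congr rfl h, sum_sub_distrib, sum_add_distrib, ← sum_mul, ← sum_mul, ← mul_sum, ← sum_mul]
  ring

/-- ★ **RATE-VARIANCE IDENTITY of a block.**  With `R = Σφ_j`, `R₁ = Σφ_jτ_j`, `R₂ = Σφ_j(τ_j² + κ_j − φ_jτ_j)` (the block sum and its first two
`u`-derivatives under the logistic Riccati law `φ′ = φτ`, `τ′ = κ − φτ`):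
`R·R₂ − R₁² = R·Σ_j φ_j(κ_j − φ_jτ_j) + ½·Σ_iΣ_j φ_iφ_j(τ_i − τ_j)²`, i.e. `(log R)″ = ⟨κ⟩_φ − ⟨φτ⟩_φ + Var_φ(τ)`. [folklore] -/
theorem blockRate_wronskian_identity {ι : Type*} (s : Finset ι) (φ τ κ : ι → ℝ) :
    (∑ j ∈ s, φ j) * (∑ j ∈ s, φ j * (τ j ^ 2 + κ j - φ j * τ j)) - (∑ j ∈ s, φ j * τ j) ^ 2
      = (∑ j ∈ s, φ j) * (∑ j ∈ s, φ j * (κ j - φ j * τ j))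
        + (1 / 2) * ∑ i ∈ s, ∑ j ∈ s, φ i * φ j * (τ i - τ j) ^ 2 := by
  rw [blockRate_lagrange]
  have h : ∑ j ∈ s, φ j * (τ j ^ 2 + κ j - φ j * τ j)
      = (∑ j ∈ s, φ j * τ j ^ 2) + ∑ j ∈ s, φ j * (κ j - φ j * τ j) := by
    rw [← sum_add_distrib]
    refine sum_congr rfl fun j _ => ?_
    ring
  rw [h]
  ring

/-- The dispersion term is non-negative on a block of non-negative weights. [folklore] -/
theorem blockRate_dispersion_nonneg {ι : Type*} (s : Finset ι) (φ τ : ι → ℝ) (hφ : ∀ j ∈ s, 0 ≤ φ j) :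
    0 ≤ ∑ i ∈ s, ∑ j ∈ s, φ i * φ j * (τ i - τ j) ^ 2 :=
  sum_nonneg fun i hi => sum_nonneg fun j hj => mul_nonneg (mul_nonneg (hφ i hi) (hφ j hj)) (sq_nonneg _)

/-- **Descent bound**: for non-negative weights and non-negative capacity ramps `κ_j ≥ 0`,
`R·R₂ − R₁² ≥ −R·Σ_j φ_j²τ_j` — the block rate can fall only through `φ²`-weighted POSITIVE lag. [folklore] -/
theorem blockRate_wronskian_ge {ι : Type*} (s : Finset ι) (φ τ κ : ι → ℝ) (hφ : ∀ j ∈ s, 0 ≤ φ j)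
    (hκ : ∀ j ∈ s, 0 ≤ κ j) :
    -((∑ j ∈ s, φ j) * ∑ j ∈ s, φ j ^ 2 * τ j)
      ≤ (∑ j ∈ s, φ j) * (∑ j ∈ s, φ j * (τ j ^ 2 + κ j - φ j * τ j)) - (∑ j ∈ s, φ j * τ j) ^ 2 := by
  rw [blockRate_wronskian_identity]
  have hR : 0 ≤ ∑ j ∈ s, φ j := sum_nonneg hφ
  have hD := blockRate_dispersion_nonneg s φ τ hφ
  have hK : 0 ≤ ∑ j ∈ s, φ j * κ j := sum_nonneg fun j hj => mul_nonneg (hφ j hj) (hκ j hj)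
  have hsplit : ∑ j ∈ s, φ j * (κ j - φ j * τ j) = (∑ j ∈ s, φ j * κ j) - ∑ j ∈ s, φ j ^ 2 * τ j := by
    rw [← sum_sub_distrib]
    refine sum_congr rfl fun j _ => ?_
    ring
  rw [hsplit, mul_sub]
  nlinarith [mul_nonneg hR hK]

/-! ## §2 Calculus wiring: block sums under the logistic Riccati law -/

/-- The block sum `R = Σφ_j` has derivative `R₁ = Σφ_jτ_j` when each `φ_j′ = φ_jτ_j`. [folklore] -/
theorem hasDerivAt_blockSum {ι : Type*} (s : Finset ι) (φ τ : ι → ℝ → ℝ) (u : ℝ)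
    (hφ : ∀ j ∈ s, HasDerivAt (φ j) (φ j u * τ j u) u) :
    HasDerivAt (fun v => ∑ j ∈ s, φ j v) (∑ j ∈ s, φ j u * τ j u) u :=
  HasDerivAt.fun_sum (u := s) (A := fun j => φ j) (A' := fun j => φ j u * τ j u) hφ

/-- The first-moment sum `R₁ = Σφ_jτ_j` has derivative `R₂ = Σφ_j(τ_j² + κ_j − φ_jτ_j)` when `φ_j′ = φ_jτ_j` and `τ_j′ = κ_j − φ_jτ_j`. [folklore] -/
theorem hasDerivAt_blockRate_sum {ι : Type*} (s : Finset ι) (φ τ κ : ι → ℝ → ℝ) (u : ℝ)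
    (hφ : ∀ j ∈ s, HasDerivAt (φ j) (φ j u * τ j u) u)
    (hτ : ∀ j ∈ s, HasDerivAt (τ j) (κ j u - φ j u * τ j u) u) :
    HasDerivAt (fun v => ∑ j ∈ s, φ j v * τ j v)
      (∑ j ∈ s, φ j u * (τ j u ^ 2 + κ j u - φ j u * τ j u)) u := by
  have h : ∀ j ∈ s, HasDerivAt (fun v => φ j v * τ j v) (φ j u * (τ j u ^ 2 + κ j u - φ j u * τ j u)) u :=
    fun j hj => ((hφ j hj).mul (hτ j hj)).congr_deriv (by ring)
  exact HasDerivAt.fun_sum (u := s) (A := fun j => fun v => φ j v * τ j v)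
    (A' := fun j => φ j u * (τ j u ^ 2 + κ j u - φ j u * τ j u)) h

/-- ★ **BLOCK-RATE DESCENT LAW** (calculus form).  Under the logistic Riccati law with non-negative weights, non-negative capacity ramps and
`R(u) > 0`, the block rate `A = R₁/R = (log R)′` has derivative `(R·R₂ − R₁²)/R²`, which is at least `−(Σ_j φ_j²τ_j)/R`. [folklore] -/
theorem blockRate_deriv_ge {ι : Type*} (s : Finset ι) (φ τ κ : ι → ℝ → ℝ) (u : ℝ)
    (hφ : ∀ j ∈ s, HasDerivAt (φ j) (φ j u * τ j u) u)
    (hτ : ∀ j ∈ s, HasDerivAt (τ j) (κ j u - φ j u * τ j u) u)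
    (hpos : ∀ j ∈ s, 0 ≤ φ j u) (hκ : ∀ j ∈ s, 0 ≤ κ j u) (hR : 0 < ∑ j ∈ s, φ j u) :
    ∃ A' : ℝ, HasDerivAt (fun v => (∑ j ∈ s, φ j v * τ j v) / ∑ j ∈ s, φ j v) A' u ∧
      -(∑ j ∈ s, φ j u ^ 2 * τ j u) / (∑ j ∈ s, φ j u) ≤ A' := by
  have h1 := hasDerivAt_blockRate_sum s φ τ κ u hφ hτ
  have h0 := hasDerivAt_blockSum s φ τ u hφ
  refine ⟨_, h1.div h0 hR.ne', ?_⟩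
  have hW := blockRate_wronskian_ge s (fun j => φ j u) (fun j => τ j u) (fun j => κ j u) hpos hκ
  rw [div_le_div_iff₀ hR (pow_pos hR 2)]
  have hR2 : (∑ j ∈ s, φ j u) ^ 2 = (∑ j ∈ s, φ j u) * ∑ j ∈ s, φ j u := sq _
  rw [hR2]
  nlinarith [hW, hR]

/-- **Corollary**: where no row of the block lags (`τ_j ≤ 0`, i.e. `φ_j ≥ K_j`: every switched row LEADS its capacity) the block rate is
non-decreasing. [folklore] -/
theorem blockRate_deriv_nonneg_of_lag_nonpos {ι : Type*} (s : Finset ι) (φ τ κ : ι → ℝ → ℝ) (u : ℝ)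
    (hφ : ∀ j ∈ s, HasDerivAt (φ j) (φ j u * τ j u) u)
    (hτ : ∀ j ∈ s, HasDerivAt (τ j) (κ j u - φ j u * τ j u) u)
    (hpos : ∀ j ∈ s, 0 ≤ φ j u) (hκ : ∀ j ∈ s, 0 ≤ κ j u) (hR : 0 < ∑ j ∈ s, φ j u)
    (hlag : ∀ j ∈ s, τ j u ≤ 0) :
    ∃ A' : ℝ, HasDerivAt (fun v => (∑ j ∈ s, φ j v * τ j v) / ∑ j ∈ s, φ j v) A' u ∧ 0 ≤ A' := by
  obtain ⟨A', hA', hge⟩ := blockRate_deriv_ge s φ τ κ u hφ hτ hpos hκ hR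
  refine ⟨A', hA', le_trans ?_ hge⟩
  rw [le_div_iff₀ hR, zero_mul, neg_nonneg]
  exact sum_nonpos fun j hj => mul_nonpos_of_nonneg_of_nonpos (sq_nonneg _) (hlag j hj)

end ProductPlusOne

end Summit.ValiantsHypothesis.ValiantsHypothesis.Theorems.LacunarySymmetroidMatrixDescartes
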